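import Literature.Analysis.FluidPDE.LerayHopfCrossIdentityTorus
import Literature.Analysis.FluidPDE.NSUniqueness2DProofs
import Literature.Analysis.FluidPDE.NSUniqueness2HalfDEstimates
import Literature.Analysis.FunctionSpaces.TorusSobolevL4
import Literature.Analysis.FluidPDE.DuchonRobert
import HarnessLib

/-!
# Lions' energy equality in `L⁴(0,T; L⁴(T^d))`, `2 ≤ d ≤ 4` — the corrected form of
`lions_energy_equality`, proved

Analysis/FluidPDE file (theorem-only). The named fact
`Literature.Analysis.FluidPDE.lions_energy_equality` (`FluidPDE/DuchonRobert`, turb.S23; J.-L. Lions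
1960, Shinbrot 1974) is false as stated — its conclusion includes the unconstrained slice
`t = 0` (`FluidPDE/DuchonRobertLionsCounterexample`). This file states and **proves** the
corrected form `Literature.Analysis.FluidPDE.lions_energy_equality_Ioc`: for a Leray–Hopf weak
solution `u` of the forced Navier–Stokes/Euler system on `T^d × [0,T)`, `2 ≤ d ≤ 4`, with datum
`u₀ ∈ L²`, a jointly measurable force `f ∈ L¹(0,T; L²)` and `u ∈ L⁴(0,T; L⁴)`, the energy
equality `½‖u(t)‖² + ν∫₀ᵗ‖∇u‖₂² = ½‖u₀‖² + ∫₀ᵗ∫⟪f, u⟫` holds for **every `t ∈ (0, T]`** (Lions,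
Rend. Sem. Mat. Univ. Padova 30 (1960); Shinbrot, SIAM J. Math. Anal. 5 (1974), Thm. with
`p = r = 4`; Beirão da Veiga–Yang 2020, Thm. 1.1 (i)).

## Proof, as formalised (Galerkin form of the Lions–Shinbrot argument)

Instead of mollifying `u` in time (Shinbrot) we test with the Fourier truncations `P_N u(s)`
(`Torus.fourierTruncate`), which are admissible smooth divergence-free fields, exactly as in the
tree's cross identity (`FluidPDE/LerayHopfCrossIdentityTorus`) and two-dimensional uniqueness
programme (`FluidPDE/NSUniqueness2DProofs`):

* **`L¹(0,T;L²)` forces.** The time-sliced weak formulation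
  `⟨u(t),Ψ⟩ = ⟨u₀,Ψ⟩ + ∫₀ᵗ Φ[u;Ψ]`, `Φ[u;Ψ](s) = ∫(⟪u,(u·∇)Ψ⟫ + ν⟪u,ΔΨ⟫ + ⟪f,Ψ⟫)`, and the
  integrability of the fluxes are re-derived for a jointly measurable `f ∈ L¹(0,T;L²)`
  (`Torus.force_L1L2_bookkeeping`, `Torus.IsLerayHopfOn.integrableOn_flux_L1L2`,
  `Torus.IsLerayHopfOn.integral_inner_eq_add_setIntegral_L1L2`; the tree's versions assume
  `f ∈ L²((0,T) × T^d)`).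
* **The identity at level `N`** (`Torus.IsLerayHopfOn.integral_inner_fourierTruncate_self_eq`):
  `‖P_N u(t)‖² = ‖P_N u₀‖² + 2∫_{(0,t]} Φ[u; P_N u(s)](s) ds` for every `t ∈ (0,T]` — the
  diagonal of Serrin's cross identity: along the frame `g_{kjc}` each coefficient
  `⟨u(t), gᵢ⟩` has the time-sliced representation, and the product formula for primitives
  (`FunctionSpaces.mul_eq_add_setIntegral_of_eq_add_setIntegral`) with the linearity of
  `Ψ ↦ Φ[u;Ψ]` over the frame expansion of `P_N u(s)` gives the identity.
* **The flux against `P_N u(s)` splits** as `∫⟪u,(u·∇)P_N u⟫ - ν‖∇P_N u‖₂² + ∫⟪f, P_N u⟫`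
  (`Torus.flux_fourierTruncate_self_split`).
* **`N → ∞`**: `‖P_N u(t)‖² → ‖u(t)‖²`, `‖P_N u₀‖² → ‖u₀‖²` (Parseval);
  `∫₀ᵗ ‖∇P_N u‖₂² → ∫₀ᵗ ‖∇u‖₂²` (monotone convergence,
  `Torus.IsLerayHopfOn.tendsto_setIntegral_toReal_eGradNormSq_fourierTruncate`);
  `∫₀ᵗ∫⟪f, P_N u⟫ → ∫₀ᵗ∫⟪f, u⟫` (dominated convergence, bound `‖f(s)‖₂‖u(s)‖₂`,
  `Torus.IsLerayHopfOn.tendsto_setIntegral_work_fourierTruncate`); and **the nonlinear term tends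
  to zero** (`Torus.IsLerayHopfOn.tendsto_setIntegral_inner_convect_fourierTruncate_self`):
  slice-wise `∫⟪P_N u,(u·∇)P_N u⟫ = 0` by weak incompressibility (tested against `½|P_N u|²`), so
  `∫⟪u,(u·∇)P_N u⟫ = ∫⟪u - P_N u,(u·∇)P_N u⟫`, bounded by `‖u - P_N u‖₄ ‖u‖₄ ‖∇u‖₂` (Hölder
  `(4,4,2)`, `‖∇P_N u‖₂ ≤ ‖∇u‖₂`), which tends to `0` because the `H¹` norm of `u(s) - P_N u(s)`
  is the tail of a convergent series and `H¹(T^d) ⊂ L⁴(T^d)` for `2 ≤ d ≤ 4`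
  (`Torus.lintegral_enorm_pow_four_le_eSobolevNorm`,
  `Torus.tendsto_lintegral_enorm_pow_four_fourierTruncate_sub_of_card_le_four` — the only
  dimension-dependent step); in time the term is dominated by `‖u(s)‖₄² ‖∇u(s)‖₂`, integrable
  by Cauchy–Schwarz since `u ∈ L⁴L⁴ ∩ L²H¹`.
* Uniqueness of limits gives `‖u(t)‖² = ‖u₀‖² + 2(-ν∫₀ᵗ‖∇u‖₂² + ∫₀ᵗ∫⟪f,u⟫)`.

## Mathlib / tree search

Mathlib (this pin) has no Navier–Stokes theory; used: dominated and monotone convergence,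
`integral_toReal`, Hölder (`ENNReal.lintegral_mul_le_Lp_mul_Lq`), `ENNReal.tendsto_tsum_compl_atTop_zero`.
Tree: the whole-space Lions theorem `lions_energy_equality_L4_holds` (`FluidPDE/NSGaldiEnergyEqualityHolds`,
`ℝ³`, `f = 0`, Serrin's doubling in time) is a different vocabulary (`Fluid.IsLerayHopfOn`, weak
gradients); on the torus the cross identity, the time-sliced formulation, the trilinear Hölder
tools (`Torus.lintegral_enorm_inner_convect_le`, `Torus.integral_inner_self_convect_eq_zero_of_isWeaklyDivFree`),
the spectral measurability of Leray–Hopf solutions and `H¹ ⊂ L⁴` (`TorusSobolevL4`) are reused.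

## References

* J.-L. Lions, *Sur la régularité et l'unicité des solutions turbulentes des équations de Navier
  Stokes*, Rend. Sem. Mat. Univ. Padova 30 (1960), 16–23.
* M. Shinbrot, *The energy equation for the Navier–Stokes system*, SIAM J. Math. Anal. 5 (1974),
  948–954. [Shinbrot1974]
* H. Beirão da Veiga, J. Yang, Nonlinear Anal. 196 (2020) = arXiv:1912.10249, Thm. 1.1.
* J. Serrin, *The initial value problem for the Navier–Stokes equations*, in: Nonlinear Problems
  (Madison 1962), 1963, §4. [Serrin1963]
* S. Kuksin, A. Shirikyan, *Mathematics of Two-Dimensional Turbulence*, CUP 2012, Prop. 2.1.7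
  (2.11), (2.16). [KuksinShirikyan2012]
* R. Temam, *Navier–Stokes Equations: Theory and Numerical Analysis*, North-Holland 1979, Ch. II
  §1.1, Lemma 1.2 (`H¹ ⊂ L⁴`, `n ≤ 4`); *Navier–Stokes Equations*, 3rd ed. 1984, Ch. III §1.1. [Temam1979] [Temam1984]
-/

noncomputable section

open MeasureTheory TopologicalSpace Set Function Filter Topology UnitAddTorus
open scoped InnerProductSpace RealInnerProductSpace ENNReal NNReal ContDiff

namespace Literature.Analysis.FluidPDE

namespace Torus

variable {d : Type*} [Fintype d] [DecidableEq d]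

/-! ### Forces in `L¹(0,T; L²(T^d))`: bookkeeping -/

section Force

variable {T : ℝ} {f : ℝ → UnitAddTorus d → EuclideanSpace ℝ d}

omit [DecidableEq d] in
/-- On the probability space `T^d`, `∫ ‖g‖ ≤ ‖g‖_{L²}` for `g ∈ L²`. [folklore] -/
theorem integral_norm_le_toReal_eLpNorm_two {g : UnitAddTorus d → EuclideanSpace ℝ d}
    (hg : MemLp g 2 volume) : ∫ x, ‖g x‖ ≤ (eLpNorm g 2 volume).toReal := by
  rw [integral_norm_eq_lintegral_enorm hg.1, ← eLpNorm_one_eq_lintegral_enorm]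
  exact ENNReal.toReal_mono hg.2.ne
    (eLpNorm_le_eLpNorm_of_exponent_le (by norm_num : (1 : ℝ≥0∞) ≤ 2) hg.1)

omit [DecidableEq d] in
/-- **Bookkeeping for a force `f ∈ L¹(0,T; L²(T^d))`** (jointly measurable, guarded mixed
class `MemLqLp 1 2`): a.e. slice is in `L²` (in particular integrable), and the slice norm
`s ↦ ‖f(s)‖_{L²}` is integrable on `(0, T)`. [folklore] -/
theorem force_L1L2_bookkeeping
    (hfm : AEStronglyMeasurable (FunctionSpaces.Torus.stLift f) (volume.restrict (Ioo 0 T ×ˢ univ)))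
    (hf : MemLqLp 1 2 f (Ioo 0 T)) :
    (∀ᵐ s ∂(volume.restrict (Ioo 0 T)), MemLp (f s) 2 volume) ∧
      Integrable (fun s => (eLpNorm (f s) 2 volume).toReal) (volume.restrict (Ioo 0 T)) := by
  have hf' : AEStronglyMeasurable (uncurry f) ((volume.restrict (Ioo 0 T)).prod volume) := by
    have h := FunctionSpaces.Torus.aestronglyMeasurable_uncurry_of_stLift_restrict hfm
    rwa [Measure.volume_eq_prod, ← Measure.prod_restrict, Measure.restrict_univ] at h
  refine ⟨hf.1, ?_⟩
  -- measurability of the slice norm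
  have hl : AEMeasurable (fun s => ∫⁻ x, ‖f s x‖ₑ ^ (2 : ℝ)) (volume.restrict (Ioo 0 T)) :=
    (hf'.aemeasurable.enorm.pow_const _).lintegral_prod_right'
  have hN : AEMeasurable (fun s => eLpNorm (f s) 2 volume) (volume.restrict (Ioo 0 T)) := by
    have h2 : (fun s => eLpNorm (f s) 2 volume) = fun s => (∫⁻ x, ‖f s x‖ₑ ^ (2 : ℝ)) ^ (1 / (2 : ℝ)) := by
      funext s
      rw [eLpNorm_eq_lintegral_rpow_enorm_toReal two_ne_zero ENNReal.ofNat_ne_top, ENNReal.toReal_ofNat]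
    rw [h2]
    exact hl.pow_const _
  refine (memLp_one_iff_integrable.1 ⟨hN.ennreal_toReal.aestronglyMeasurable, ?_⟩)
  -- the `L¹` norm in time is the guarded mixed norm
  have h := hf.2
  rw [FluidPDE.eLqLpNorm_def] at h
  exact h

omit [DecidableEq d] in
/-- A.e. slice of an `L¹(0,T;L²)` force is integrable. [folklore] -/
theorem ae_integrable_force_slice' (hf : MemLqLp 1 2 f (Ioo 0 T)) :
    ∀ᵐ s ∂(volume.restrict (Ioo 0 T)), Integrable (f s) volume :=
  hf.1.mono fun _ hs => hs.integrable one_le_two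

end Force

/-! ### The time-sliced weak formulation with an `L¹(0,T;L²)` force -/

section Slice

variable {T ν : ℝ} {f u : ℝ → UnitAddTorus d → EuclideanSpace ℝ d}
  {u₀ : UnitAddTorus d → EuclideanSpace ℝ d}

/-- **The flux is integrable in time** (`L¹(0,T;L²)` force): for a Leray–Hopf solution `u` and a
smooth field `Ψ`, `s ↦ ∫ (⟪u, (u·∇)Ψ⟫ + ν⟪u, ΔΨ⟫ + ⟪f, Ψ⟫)` is integrable on `(0, T)` — the first
two terms are bounded a.e. by the energy, the third by `‖Ψ‖_∞ ‖f(s)‖_{L²}` (twin of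
`Torus.IsLerayHopfOn.integrableOn_flux`, which assumes `f ∈ L²((0,T) × T^d)`). [folklore] -/
theorem IsLerayHopfOn.integrableOn_flux_L1L2 (hu : IsLerayHopfOn T ν f u₀ u)
    (hfm : AEStronglyMeasurable (FunctionSpaces.Torus.stLift f) (volume.restrict (Ioo 0 T ×ˢ univ)))
    (hf : MemLqLp 1 2 f (Ioo 0 T))
    {Ψ : UnitAddTorus d → EuclideanSpace ℝ d} (hΨ : FunctionSpaces.Torus.IsSmooth Ψ) :
    IntegrableOn
      (fun s => ∫ x, (⟪u s x, FunctionSpaces.Torus.convect (u s) Ψ x⟫ + ν * ⟪u s x, FunctionSpaces.Torus.laplacian Ψ x⟫ + ⟪f s x, Ψ x⟫))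
      (Ioo 0 T) := by
  obtain ⟨C, hC0, hC⟩ := hu.exists_integral_norm_sq_le
  obtain ⟨D, hD0, hD⟩ := exists_sum_norm_partialDeriv_le hΨ
  obtain ⟨KL, hKL0, hKL⟩ := exists_nonneg_forall_norm_le_of_continuous hΨ.laplacian.continuous
  obtain ⟨KP, hKP0, hKP⟩ := exists_nonneg_forall_norm_le_of_continuous hΨ.continuous
  obtain ⟨hfs, hNint⟩ := force_L1L2_bookkeeping hfm hf
  refine ⟨hu.aestronglyMeasurable_flux hfm hΨ, ?_⟩
  -- domination by an integrable function of `s`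
  have hdom : ∀ᵐ s ∂(volume.restrict (Ioo 0 T)),
      ‖∫ x, (⟪u s x, FunctionSpaces.Torus.convect (u s) Ψ x⟫ + ν * ⟪u s x, FunctionSpaces.Torus.laplacian Ψ x⟫ + ⟪f s x, Ψ x⟫)‖ ≤
        (D * C + |ν| * KL * (2⁻¹ * (1 + C))) + KP * (eLpNorm (f s) 2 volume).toReal := by
    filter_upwards [hC, hfs, ae_restrict_mem measurableSet_Ioo] with s hs hfs2 hsI
    have hmem : MemLp (u s) 2 volume := hu.memLp s (Ioo_subset_Icc_self hsI)
    have i1 := integrable_inner_convect_self hmem hΨ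
    have i2 : Integrable (fun x => ⟪u s x, FunctionSpaces.Torus.laplacian Ψ x⟫) volume :=
      FunctionSpaces.Torus.integrable_inner_of_continuous (hmem.integrable one_le_two) hΨ.laplacian.continuous
    have i3 : Integrable (fun x => ⟪f s x, Ψ x⟫) volume :=
      FunctionSpaces.Torus.integrable_inner_of_continuous (hfs2.integrable one_le_two) hΨ.continuous
    have i12 : Integrable (fun x => ⟪u s x, FunctionSpaces.Torus.convect (u s) Ψ x⟫ + ν * ⟪u s x, FunctionSpaces.Torus.laplacian Ψ x⟫)
        volume := i1.add (i2.const_mul ν)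
    rw [Real.norm_eq_abs, integral_add i12 i3, integral_add i1 (i2.const_mul ν),
      integral_const_mul]
    have b1 : |∫ x, ⟪u s x, FunctionSpaces.Torus.convect (u s) Ψ x⟫| ≤ D * C :=
      (abs_integral_inner_convect_self_le hmem hΨ hD).trans (by gcongr)
    have b2 : |ν * ∫ x, ⟪u s x, FunctionSpaces.Torus.laplacian Ψ x⟫| ≤ |ν| * KL * (2⁻¹ * (1 + C)) := by
      rw [abs_mul, mul_assoc]
      refine mul_le_mul_of_nonneg_left ?_ (abs_nonneg ν)
      refine (abs_integral_inner_le_of_norm_le (hmem.integrable one_le_two) hKL).trans ?_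
      refine mul_le_mul_of_nonneg_left ((integral_norm_le_of_memLp_two hmem).trans ?_) hKL0
      gcongr
    have b3 : |∫ x, ⟪f s x, Ψ x⟫| ≤ KP * (eLpNorm (f s) 2 volume).toReal :=
      (abs_integral_inner_le_of_norm_le (hfs2.integrable one_le_two) hKP).trans
        (mul_le_mul_of_nonneg_left (integral_norm_le_toReal_eLpNorm_two hfs2) hKP0)
    calc _ ≤ |∫ x, ⟪u s x, FunctionSpaces.Torus.convect (u s) Ψ x⟫| + |ν * ∫ x, ⟪u s x, FunctionSpaces.Torus.laplacian Ψ x⟫| +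
          |∫ x, ⟪f s x, Ψ x⟫| := abs_add_three _ _ _
      _ ≤ _ := by linarith
  refine HasFiniteIntegral.mono' (g := fun s =>
    (D * C + |ν| * KL * (2⁻¹ * (1 + C))) + KP * (eLpNorm (f s) 2 volume).toReal) ?_ hdom
  have : IsFiniteMeasure (volume.restrict (Ioo (0 : ℝ) T)) := ⟨by
    rw [Measure.restrict_apply_univ]; exact measure_Ioo_lt_top⟩
  exact ((integrable_const _).add (hNint.const_mul _)).hasFiniteIntegral

/-- **The time-sliced weak formulation of a Leray–Hopf solution on the torus**, `L¹(0,T;L²)`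
force: for `u` Leray–Hopf on `T^d × [0, T)`, `T > 0`, a jointly measurable force
`f ∈ L¹(0,T; L²)` and a smooth divergence-free field `Ψ`, for **every** `t ∈ (0, T]`
`⟨u(t), Ψ⟩ = ⟨u₀, Ψ⟩ + ∫_{(0,t]} ∫ (⟪u, (u·∇)Ψ⟫ + ν ⟪u, ΔΨ⟫ + ⟪f, Ψ⟫) dx ds`
(Temam 1984, Ch. III §1.1, (1.22) ⇔ (1.25) and Lemma 1.1; twin of
`Torus.IsLerayHopfOn.integral_inner_eq_add_setIntegral`, same proof). [cite: Temam1984, Ch. III §1.1 (1.22)–(1.25), Lemma 1.1] -/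
theorem IsLerayHopfOn.integral_inner_eq_add_setIntegral_L1L2 (hu : IsLerayHopfOn T ν f u₀ u)
    (hT : 0 < T) (hfm : AEStronglyMeasurable (FunctionSpaces.Torus.stLift f) (volume.restrict (Ioo 0 T ×ˢ univ)))
    (hf : MemLqLp 1 2 f (Ioo 0 T))
    {Ψ : UnitAddTorus d → EuclideanSpace ℝ d} (hΨ : FunctionSpaces.Torus.IsSmooth Ψ) (hΨdiv : FunctionSpaces.Torus.IsDivFree Ψ)
    {t : ℝ} (ht : t ∈ Ioc 0 T) :
    ∫ x, ⟪u t x, Ψ x⟫ = (∫ x, ⟪u₀ x, Ψ x⟫) + ∫ s in Ioc 0 t,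
      ∫ x, (⟪u s x, FunctionSpaces.Torus.convect (u s) Ψ x⟫ + ν * ⟪u s x, FunctionSpaces.Torus.laplacian Ψ x⟫ + ⟪f s x, Ψ x⟫) := by
  have hUint := hu.integrableOn_integral_inner hΨ.continuous
  have hFint := hu.integrableOn_flux_L1L2 hfm hf hΨ
  have hUcont : ContinuousOn (fun s => ∫ x, ⟪u s x, Ψ x⟫) (Ioc 0 T) :=
    (hu.weak_continuous Ψ (hΨ.memLp 2)).1
  have hfL1 : ∀ᵐ s ∂(volume.restrict (Ioo 0 T)), Integrable (f s) volume := ae_integrable_force_slice' hf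
  have hid : ∀ η : ℝ → ℝ, ContDiff ℝ ∞ η → HasCompactSupport η → tsupport η ⊆ Iio T →
      (∫ s in Ioo 0 T, (deriv η s * (∫ x, ⟪u s x, Ψ x⟫) +
        η s * ∫ x, (⟪u s x, FunctionSpaces.Torus.convect (u s) Ψ x⟫ + ν * ⟪u s x, FunctionSpaces.Torus.laplacian Ψ x⟫ + ⟪f s x, Ψ x⟫))) +
        η 0 * (∫ x, ⟪u₀ x, Ψ x⟫) = 0 := fun η hη hηc hηT =>
    hu.weak.test_smul (fun s hs => hu.memLp s (Ioo_subset_Icc_self hs)) hfL1 hΨ hΨdiv hη hηc hηT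
  have hIoo : ∀ t ∈ Ioo 0 T, ∫ x, ⟪u t x, Ψ x⟫ = (∫ x, ⟪u₀ x, Ψ x⟫) + ∫ s in Ioc 0 t,
      ∫ x, (⟪u s x, FunctionSpaces.Torus.convect (u s) Ψ x⟫ + ν * ⟪u s x, FunctionSpaces.Torus.laplacian Ψ x⟫ + ⟪f s x, Ψ x⟫) :=
    fun t ht => FunctionSpaces.eq_add_setIntegral_of_forall_test hUint hFint (hUcont.mono Ioo_subset_Ioc_self)
      hid ht
  rcases lt_or_eq_of_le ht.2 with htT | rfl
  · exact hIoo t ⟨ht.1, htT⟩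
  · -- the endpoint: both sides are limits from the left within `(0, T)`
    haveI : (𝓝[Ioo 0 t] t).NeBot := by
      refine mem_closure_iff_nhdsWithin_neBot.1 ?_
      rw [closure_Ioo hT.ne]
      exact right_mem_Icc.2 hT.le
    set Fl : ℝ → ℝ := fun s =>
      ∫ x, (⟪u s x, FunctionSpaces.Torus.convect (u s) Ψ x⟫ + ν * ⟪u s x, FunctionSpaces.Torus.laplacian Ψ x⟫ + ⟪f s x, Ψ x⟫)
    have h1 : Tendsto (fun s => ∫ x, ⟪u s x, Ψ x⟫) (𝓝[Ioo 0 t] t) (𝓝 (∫ x, ⟪u t x, Ψ x⟫)) :=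
      (hUcont t ⟨hT, le_rfl⟩).mono Ioo_subset_Ioc_self
    have hFint' : IntegrableOn Fl (Icc 0 t) :=
      (integrableOn_Icc_iff_integrableOn_Ioo (by simp) (by simp)).2 hFint
    have h2 : Tendsto (fun τ => (∫ x, ⟪u₀ x, Ψ x⟫) + ∫ s in Ioc 0 τ, Fl s) (𝓝[Ioo 0 t] t)
        (𝓝 ((∫ x, ⟪u₀ x, Ψ x⟫) + ∫ s in Ioc 0 t, Fl s)) := by
      have hprim : ContinuousWithinAt (fun τ => ∫ s in Ioc 0 τ, Fl s) (Ioo 0 t) t :=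
        (intervalIntegral.continuousOn_primitive hFint' t (right_mem_Icc.2 hT.le)).mono
          Ioo_subset_Icc_self
      exact tendsto_const_nhds.add hprim
    have heq : (fun s => ∫ x, ⟪u s x, Ψ x⟫) =ᶠ[𝓝[Ioo 0 t] t]
        fun τ => (∫ x, ⟪u₀ x, Ψ x⟫) + ∫ s in Ioc 0 τ, Fl s :=
      eventually_mem_nhdsWithin.mono fun τ hτ => hIoo τ hτ
    exact tendsto_nhds_unique (h1.congr' heq) h2

end Slice

/-! ### The energy identity at truncation level `M` -/

section LevelN

variable {T ν : ℝ} {f u : ℝ → UnitAddTorus d → EuclideanSpace ℝ d}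
  {u₀ : UnitAddTorus d → EuclideanSpace ℝ d}

/-- **The flux against the truncations `P_M u(s)` is integrable in time** (`L¹(0,T;L²)` force):
`s ↦ ∫(⟪u,(u·∇)P_M u⟫ + ν⟪u,ΔP_M u⟫ + ⟪f,P_M u⟫)(s)` is integrable on `(0, T)` (along the frame
it is `∑ᵢ ⟪u(s), gᵢ⟫ · (flux of u against gᵢ)`, bounded coefficients times integrable fluxes;
twin of `Torus.IsLerayHopfOn.integrableOn_flux_fourierTruncate`). [folklore] -/
theorem IsLerayHopfOn.integrableOn_flux_fourierTruncate_L1L2 (hu : IsLerayHopfOn T ν f u₀ u)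
    (hfm : AEStronglyMeasurable (FunctionSpaces.Torus.stLift f) (volume.restrict (Ioo 0 T ×ˢ univ)))
    (hf : MemLqLp 1 2 f (Ioo 0 T)) (M : ℕ) :
    IntegrableOn (fun s => ∫ x, (⟪u s x, FunctionSpaces.Torus.convect (u s) (FunctionSpaces.Torus.fourierTruncate M (u s)) x⟫ +
        ν * ⟪u s x, FunctionSpaces.Torus.laplacian (FunctionSpaces.Torus.fourierTruncate M (u s)) x⟫ +
        ⟪f s x, FunctionSpaces.Torus.fourierTruncate M (u s) x⟫)) (Ioo 0 T) := by
  classical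
  set I : Finset ((d → ℤ) × d × Bool) := FunctionSpaces.Torus.freqBall M ×ˢ ((Finset.univ : Finset d) ×ˢ (Finset.univ : Finset Bool))
    with hI
  set a : (d → ℤ) × d × Bool → UnitAddTorus d → EuclideanSpace ℝ d := fun i => frameField i.1 i.2.1 i.2.2 with ha
  have ha_smooth : ∀ i, FunctionSpaces.Torus.IsSmooth (a i) := fun i => isSmooth_frameField _ _ _
  have ha_cont : ∀ i, Continuous (a i) := fun i => continuous_frameField _ _ _
  -- the frame expansion, for a.e. `s`
  have hIdent : ∀ᵐ s ∂(volume.restrict (Ioo 0 T)),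
      ∑ i ∈ I, (∫ x, ⟪u s x, a i x⟫) * ∫ x, (⟪u s x, FunctionSpaces.Torus.convect (u s) (a i) x⟫ +
          ν * ⟪u s x, FunctionSpaces.Torus.laplacian (a i) x⟫ + ⟪f s x, a i x⟫) =
        ∫ x, (⟪u s x, FunctionSpaces.Torus.convect (u s) (FunctionSpaces.Torus.fourierTruncate M (u s)) x⟫ +
          ν * ⟪u s x, FunctionSpaces.Torus.laplacian (FunctionSpaces.Torus.fourierTruncate M (u s)) x⟫ +
          ⟪f s x, FunctionSpaces.Torus.fourierTruncate M (u s) x⟫) := by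
    filter_upwards [ae_integrable_force_slice' hf, ae_restrict_mem measurableSet_Ioo] with s hs hsI
    have hsT : s ∈ Ioc 0 T := Ioo_subset_Ioc_self hsI
    have hus : MemLp (u s) 2 volume := hu.memLp s ⟨hsT.1.le, hsT.2⟩
    rw [sum_mul_flux_eq I (fun i => ∫ x, ⟪u s x, a i x⟫) ha_smooth ν hus hs,
      fourierTruncate_eq_sum_integral_inner_smul_frameField hus (hu.isWeaklyDivFree_of_mem_Ioc hsT) M]
  -- integrability of the expansion
  have hsum : IntegrableOn (fun s => ∑ i ∈ I, (∫ x, ⟪u s x, a i x⟫) *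
      ∫ x, (⟪u s x, FunctionSpaces.Torus.convect (u s) (a i) x⟫ + ν * ⟪u s x, FunctionSpaces.Torus.laplacian (a i) x⟫ +
        ⟪f s x, a i x⟫)) (Ioo 0 T) := by
    refine integrable_finsetSum I fun i _ => ?_
    obtain ⟨C, hC⟩ := hu.exists_ae_abs_integral_inner_le (ha_cont i)
    exact (hu.integrableOn_flux_L1L2 hfm hf (ha_smooth i)).bdd_mul
      (hu.aestronglyMeasurable_integral_inner (ha_cont i))
      (hC.mono fun s hs => by rwa [Real.norm_eq_abs])
  exact hsum.congr hIdent

/-- **The energy identity of a Leray–Hopf solution at truncation level `M`.** Let `u` be a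
Leray–Hopf weak solution on `T^d × [0, T)`, `T > 0`, with viscosity `ν`, a jointly measurable
force `f ∈ L¹(0,T; L²)` and datum `u₀ ∈ L²`. Then for every truncation level `M` and every
`t ∈ (0, T]`,
`‖P_M u(t)‖²_{L²} = ‖P_M u₀‖²_{L²} + 2 ∫_{(0,t]} Φ[u; P_M u(s)](s) ds`,
`Φ[u; Ψ](s) = ∫(⟪u(s),(u(s)·∇)Ψ⟫ + ν⟪u(s),ΔΨ⟫ + ⟪f(s),Ψ⟫)` the flux of the time-sliced weak
formulation, the integrand being integrable on `(0,t]`: the Galerkin-level form of "testing the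
equation with `u` itself" (Serrin 1963, §4; Shinbrot 1974; the diagonal `U = u` of the cross
identity `Torus.IsLerayHopfOn.integral_inner_fourierTruncate_eq_add_setIntegral`, same proof along
the frame `g_{kjc}` with the product formula for primitives, here with an `L¹(0,T;L²)` force). [cite: Serrin1963, §4 (proof of Thm. 6)] -/
theorem IsLerayHopfOn.integral_inner_fourierTruncate_self_eq (hu : IsLerayHopfOn T ν f u₀ u) (hT : 0 < T)
    (hfm : AEStronglyMeasurable (FunctionSpaces.Torus.stLift f) (volume.restrict (Ioo 0 T ×ˢ univ)))
    (hf : MemLqLp 1 2 f (Ioo 0 T)) (hu₀ : MemLp u₀ 2 volume) (M : ℕ) {t : ℝ} (ht : t ∈ Ioc 0 T) :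
    IntegrableOn (fun s =>
        ∫ x, (⟪u s x, FunctionSpaces.Torus.convect (u s) (FunctionSpaces.Torus.fourierTruncate M (u s)) x⟫ +
          ν * ⟪u s x, FunctionSpaces.Torus.laplacian (FunctionSpaces.Torus.fourierTruncate M (u s)) x⟫ +
          ⟪f s x, FunctionSpaces.Torus.fourierTruncate M (u s) x⟫)) (Ioc 0 t) ∧
      ∫ x, ⟪FunctionSpaces.Torus.fourierTruncate M (u t) x, FunctionSpaces.Torus.fourierTruncate M (u t) x⟫ =
        (∫ x, ⟪FunctionSpaces.Torus.fourierTruncate M u₀ x, FunctionSpaces.Torus.fourierTruncate M u₀ x⟫) +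
          2 * ∫ s in Ioc 0 t,
            ∫ x, (⟪u s x, FunctionSpaces.Torus.convect (u s) (FunctionSpaces.Torus.fourierTruncate M (u s)) x⟫ +
              ν * ⟪u s x, FunctionSpaces.Torus.laplacian (FunctionSpaces.Torus.fourierTruncate M (u s)) x⟫ +
              ⟪f s x, FunctionSpaces.Torus.fourierTruncate M (u s) x⟫) := by
  classical
  -- ### the frame
  set I : Finset ((d → ℤ) × d × Bool) := FunctionSpaces.Torus.freqBall M ×ˢ ((Finset.univ : Finset d) ×ˢ (Finset.univ : Finset Bool))
    with hI
  set a : (d → ℤ) × d × Bool → UnitAddTorus d → EuclideanSpace ℝ d := fun i => frameField i.1 i.2.1 i.2.2 with ha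
  have ha_smooth : ∀ i, FunctionSpaces.Torus.IsSmooth (a i) := fun i => isSmooth_frameField _ _ _
  have ha_div : ∀ i, FunctionSpaces.Torus.IsDivFree (a i) := fun i => isDivFree_frameField' _ _ _
  -- ### divergence-free slices and data
  have hdivu : ∀ s ∈ Ioc 0 T, FunctionSpaces.Torus.IsWeaklyDivFree (u s) := fun s hs => hu.isWeaklyDivFree_of_mem_Ioc hs
  have hdivu₀ : FunctionSpaces.Torus.IsWeaklyDivFree u₀ := hu.isWeaklyDivFree_datum hT
  -- ### the coefficient functions, their fluxes and representations
  set A : (d → ℤ) × d × Bool → ℝ → ℝ := fun i s => ∫ x, ⟪u s x, a i x⟫ with hA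
  set φ : (d → ℤ) × d × Bool → ℝ → ℝ := fun i s =>
    ∫ x, (⟪u s x, FunctionSpaces.Torus.convect (u s) (a i) x⟫ + ν * ⟪u s x, FunctionSpaces.Torus.laplacian (a i) x⟫ + ⟪f s x, a i x⟫)
    with hφ
  have hφint : ∀ i, IntegrableOn (φ i) (Ioo 0 T) := fun i => hu.integrableOn_flux_L1L2 hfm hf (ha_smooth i)
  have hArep : ∀ i, ∀ s ∈ Ioc 0 T, A i s = (∫ x, ⟪u₀ x, a i x⟫) + ∫ r in Ioc 0 s, φ i r :=
    fun i s hs => hu.integral_inner_eq_add_setIntegral_L1L2 hT hfm hf (ha_smooth i) (ha_div i) hs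
  -- ### the product formula, mode by mode
  have hprod := fun i => FunctionSpaces.mul_eq_add_setIntegral_of_eq_add_setIntegral (hφint i) (hφint i)
    (hArep i) (hArep i) ht
  -- ### sum over the frame
  have hLHS : ∫ x, ⟪FunctionSpaces.Torus.fourierTruncate M (u t) x, FunctionSpaces.Torus.fourierTruncate M (u t) x⟫ =
      ∑ i ∈ I, A i t * A i t :=
    integral_inner_fourierTruncate_fourierTruncate_eq_sum (hu.memLp t ⟨ht.1.le, ht.2⟩)
      (hu.memLp t ⟨ht.1.le, ht.2⟩) (hdivu t ht) M
  have h0 : ∫ x, ⟪FunctionSpaces.Torus.fourierTruncate M u₀ x, FunctionSpaces.Torus.fourierTruncate M u₀ x⟫ =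
      ∑ i ∈ I, (∫ x, ⟪u₀ x, a i x⟫) * ∫ x, ⟪u₀ x, a i x⟫ :=
    integral_inner_fourierTruncate_fourierTruncate_eq_sum hu₀ hu₀ hdivu₀ M
  have hsumInt : IntegrableOn (fun s => ∑ i ∈ I, (φ i s * A i s + A i s * φ i s)) (Ioc 0 t) :=
    integrable_finsetSum I fun i _ => (hprod i).1
  have hsumEq : ∑ i ∈ I, A i t * A i t = ∑ i ∈ I, (∫ x, ⟪u₀ x, a i x⟫) * (∫ x, ⟪u₀ x, a i x⟫) +
      ∫ s in Ioc 0 t, ∑ i ∈ I, (φ i s * A i s + A i s * φ i s) := by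
    rw [integral_finsetSum I fun i _ => (hprod i).1, ← Finset.sum_add_distrib]
    exact Finset.sum_congr rfl fun i _ => (hprod i).2
  -- ### identification of the integrand for a.e. `s ∈ (0, t]`
  have hsub : Ioc 0 t ⊆ Ioc 0 T := Ioc_subset_Ioc_right ht.2
  set Φ : ℝ → ℝ := fun s =>
    ∫ x, (⟪u s x, FunctionSpaces.Torus.convect (u s) (FunctionSpaces.Torus.fourierTruncate M (u s)) x⟫ +
      ν * ⟪u s x, FunctionSpaces.Torus.laplacian (FunctionSpaces.Torus.fourierTruncate M (u s)) x⟫ +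
      ⟪f s x, FunctionSpaces.Torus.fourierTruncate M (u s) x⟫) with hΦdef
  have hIdent : ∀ᵐ s ∂(volume.restrict (Ioc 0 t)), ∑ i ∈ I, (φ i s * A i s + A i s * φ i s) = Φ s + Φ s := by
    have h1 : ∀ᵐ s ∂(volume.restrict (Ioc 0 T)), Integrable (f s) volume := by
      rw [← Measure.restrict_congr_set Ioo_ae_eq_Ioc]
      exact ae_integrable_force_slice' hf
    have h2 : ∀ᵐ s ∂(volume.restrict (Ioc 0 t)), Integrable (f s) volume :=
      ae_restrict_of_ae_restrict_of_subset hsub h1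
    filter_upwards [h2, ae_restrict_mem measurableSet_Ioc] with s hs hsI
    have hsT : s ∈ Ioc 0 T := hsub hsI
    have hus : MemLp (u s) 2 volume := hu.memLp s ⟨hsT.1.le, hsT.2⟩
    have hexp := fourierTruncate_eq_sum_integral_inner_smul_frameField hus (hdivu s hsT) M
    simp only [hΦdef]
    rw [Finset.sum_add_distrib]
    congr 1
    · calc ∑ i ∈ I, φ i s * A i s = ∑ i ∈ I, A i s * φ i s := Finset.sum_congr rfl fun i _ => mul_comm _ _
        _ = _ := sum_mul_flux_eq I (fun i => A i s) ha_smooth ν hus hs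
        _ = _ := by rw [hexp]
    · calc ∑ i ∈ I, A i s * φ i s = _ := sum_mul_flux_eq I (fun i => A i s) ha_smooth ν hus hs
        _ = _ := by rw [hexp]
  have hΦ2 : IntegrableOn (fun s => Φ s + Φ s) (Ioc 0 t) := hsumInt.congr hIdent
  have hΦ : IntegrableOn Φ (Ioc 0 t) :=
    (hΦ2.const_mul (2⁻¹ : ℝ)).congr (ae_of_all _ fun s => by ring)
  refine ⟨hΦ, ?_⟩
  rw [hLHS, hsumEq, h0, integral_congr_ae hIdent, integral_add hΦ hΦ, two_mul]

end LevelN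

/-! ### The flux against `P_N u(s)`: convective, Stokes and work terms -/

section Split

omit [DecidableEq d] in
/-- **The tested pairing against the own truncation splits** into the convective term, the
(negative) truncated dissipation and the work of the force:
`∫(⟪v,(v·∇)P_N v⟫ + ν⟪v,ΔP_N v⟫ + ⟪F,P_N v⟫) = ∫⟪v,(v·∇)P_N v⟫ - ν ‖∇P_N v‖₂² + ∫⟪F, P_N v⟫`
(`∫⟪v, ΔP_N v⟫ = -‖∇P_N v‖₂²`, `Torus.integral_inner_laplacian_fourierTruncate`). [folklore] -/
theorem flux_fourierTruncate_self_split [DecidableEq d] {v F : UnitAddTorus d → EuclideanSpace ℝ d}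
    (hv : MemLp v 2 volume) (hF : Integrable F volume) (ν : ℝ) (N : ℕ) :
    ∫ x, (⟪v x, FunctionSpaces.Torus.convect v (FunctionSpaces.Torus.fourierTruncate N v) x⟫ +
        ν * ⟪v x, FunctionSpaces.Torus.laplacian (FunctionSpaces.Torus.fourierTruncate N v) x⟫ +
        ⟪F x, FunctionSpaces.Torus.fourierTruncate N v x⟫) =
      (∫ x, ⟪v x, FunctionSpaces.Torus.convect v (FunctionSpaces.Torus.fourierTruncate N v) x⟫) -
        ν * (FunctionSpaces.Torus.eGradNormSq (FunctionSpaces.Torus.fourierTruncate N v)).toReal +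
        ∫ x, ⟪F x, FunctionSpaces.Torus.fourierTruncate N v x⟫ := by
  have hs : FunctionSpaces.Torus.IsSmooth (FunctionSpaces.Torus.fourierTruncate N v) :=
    FunctionSpaces.Torus.isSmooth_fourierTruncate _ _
  have i1 := integrable_inner_convect_self hv hs
  have i2 : Integrable (fun x => ⟪v x, FunctionSpaces.Torus.laplacian (FunctionSpaces.Torus.fourierTruncate N v) x⟫) volume :=
    FunctionSpaces.Torus.integrable_inner_of_continuous (hv.integrable one_le_two) hs.laplacian.continuous
  have i3 : Integrable (fun x => ⟪F x, FunctionSpaces.Torus.fourierTruncate N v x⟫) volume :=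
    FunctionSpaces.Torus.integrable_inner_of_continuous hF hs.continuous
  have i12 : Integrable (fun x => ⟪v x, FunctionSpaces.Torus.convect v (FunctionSpaces.Torus.fourierTruncate N v) x⟫ +
      ν * ⟪v x, FunctionSpaces.Torus.laplacian (FunctionSpaces.Torus.fourierTruncate N v) x⟫) volume :=
    i1.add (i2.const_mul ν)
  rw [integral_add i12 i3, integral_add i1 (i2.const_mul ν), integral_const_mul,
    integral_inner_laplacian_fourierTruncate (hv.integrable one_le_two) N]
  ring

end Split

/-! ### Leray–Hopf solutions: the terms of the truncated identity in the limit `N → ∞` -/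

section Limits

variable {T ν : ℝ} {f u : ℝ → UnitAddTorus d → EuclideanSpace ℝ d}
  {u₀ : UnitAddTorus d → EuclideanSpace ℝ d}

/-- Time-measurability of the truncated dissipation `s ↦ ‖∇P_N u(s)‖₂²` of a Leray–Hopf
solution (its Fourier coefficients are those of `u(s)` on the ball and `0` outside). [folklore] -/
theorem IsLerayHopfOn.aemeasurable_eGradNormSq_fourierTruncate (hu : IsLerayHopfOn T ν f u₀ u) (N : ℕ) :
    AEMeasurable (fun s => FunctionSpaces.Torus.eGradNormSq (FunctionSpaces.Torus.fourierTruncate N (u s)))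
      (volume.restrict (Ioo 0 T)) := by
  classical
  refine Torus.aemeasurable_eGradNormSq_of_coeff fun k => ?_
  by_cases hk : k ∈ FunctionSpaces.Torus.freqBall N
  · refine (hu.aestronglyMeasurable_mFourierCoeff_complexify k).congr ?_
    filter_upwards [ae_restrict_mem measurableSet_Ioo] with s hs
    rw [FunctionSpaces.Torus.mFourierCoeff_fourierTruncate ((hu.memLp s (Ioo_subset_Icc_self hs)).integrable one_le_two),
      if_pos hk]
  · refine (aestronglyMeasurable_const (b := (0 : EuclideanSpace ℂ d))).congr ?_
    filter_upwards [ae_restrict_mem measurableSet_Ioo] with s hs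
    rw [FunctionSpaces.Torus.mFourierCoeff_fourierTruncate ((hu.memLp s (Ioo_subset_Icc_self hs)).integrable one_le_two),
      if_neg hk]

/-- **The truncated energies converge**: `∫ ⟪P_N w, P_N w⟫ → ∫ ‖w‖²` for `w ∈ L²`
(Parseval along the exhausting balls). [folklore] -/
theorem tendsto_integral_inner_fourierTruncate_self {w : UnitAddTorus d → EuclideanSpace ℝ d}
    (hw : MemLp w 2 volume) :
    Tendsto (fun N => ∫ x, ⟪FunctionSpaces.Torus.fourierTruncate N w x, FunctionSpaces.Torus.fourierTruncate N w x⟫)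
      atTop (𝓝 (∫ x, ‖w x‖ ^ 2)) := by
  have h := tendsto_integral_inner_fourierTruncate_fourierTruncate hw hw
  have heq : (∫ x, ⟪w x, w x⟫) = ∫ x, ‖w x‖ ^ 2 :=
    integral_congr_ae (ae_of_all _ fun x => real_inner_self_eq_norm_sq _)
  rwa [heq] at h

/-- **The truncated dissipation converges**: for every `t ∈ (0, T]`,
`∫_{(0,t]} ‖∇P_N u(s)‖₂² ds → ∫₀ᵗ ‖∇u‖₂²` (monotone convergence along the exhausting balls,
the limit being finite for a Leray–Hopf solution). [folklore] -/
theorem IsLerayHopfOn.tendsto_setIntegral_toReal_eGradNormSq_fourierTruncate (hu : IsLerayHopfOn T ν f u₀ u)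
    {t : ℝ} (ht : t ∈ Ioc 0 T) :
    (∀ N, IntegrableOn (fun s => (FunctionSpaces.Torus.eGradNormSq (FunctionSpaces.Torus.fourierTruncate N (u s))).toReal)
      (Ioc 0 t)) ∧
    Tendsto (fun N => ∫ s in Ioc 0 t, (FunctionSpaces.Torus.eGradNormSq (FunctionSpaces.Torus.fourierTruncate N (u s))).toReal)
      atTop (𝓝 ((∫⁻ s in Ioo 0 t, FunctionSpaces.Torus.eGradNormSq (u s)).toReal)) := by
  set μt : Measure ℝ := volume.restrict (Ioo 0 t) with hμt
  have hsub : Ioo 0 t ⊆ Ioo 0 T := Ioo_subset_Ioo le_rfl ht.2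
  have hle : μt ≤ volume.restrict (Ioo 0 T) := Measure.restrict_mono hsub le_rfl
  set G : ℕ → ℝ → ℝ≥0∞ := fun N s =>
    FunctionSpaces.Torus.eGradNormSq (FunctionSpaces.Torus.fourierTruncate N (u s)) with hG
  set g : ℝ → ℝ≥0∞ := fun s => FunctionSpaces.Torus.eGradNormSq (u s) with hg
  have hG_m : ∀ N, AEMeasurable (G N) (volume.restrict (Ioo 0 T)) := fun N =>
    hu.aemeasurable_eGradNormSq_fourierTruncate N
  have hfin : ∫⁻ s in Ioo 0 t, g s ≠ ⊤ :=
    ((lintegral_mono' hle le_rfl).trans_lt hu.lintegral_eGradNormSq_lt_top).ne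
  -- ### integrability of the truncated dissipation on `(0, t]`
  have hGle : ∀ N, ∀ s ∈ Ioo 0 t, G N s ≤ g s := fun N s hs =>
    Torus.eGradNormSq_fourierTruncate_le ((hu.memLp s (Ioo_subset_Icc_self (hsub hs))).integrable one_le_two) N
  have hInt : ∀ N, IntegrableOn (fun s => (G N s).toReal) (Ioc 0 t) := by
    intro N
    rw [IntegrableOn, ← Measure.restrict_congr_set Ioo_ae_eq_Ioc]
    refine integrable_toReal_of_lintegral_ne_top ((hG_m N).mono_measure hle) (ne_top_of_le_ne_top hfin ?_)
    exact setLIntegral_mono' measurableSet_Ioo fun s hs => hGle N s hs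
  refine ⟨hInt, ?_⟩
  -- monotone convergence in `ℝ≥0∞`
  have hL : Tendsto (fun N => ∫⁻ s in Ioo 0 t, G N s) atTop (𝓝 (∫⁻ s in Ioo 0 t, g s)) := by
    have hcoef : ∀ s ∈ Ioo 0 t, ∀ N, G N s = ENNReal.ofReal (4 * Real.pi ^ 2) *
        ∑ k ∈ FunctionSpaces.Torus.freqBall N, ENNReal.ofReal (FunctionSpaces.Torus.freqNormSq k) *
          ‖mFourierCoeff (FunctionSpaces.EuclideanSpace.complexify ∘ u s) k‖ₑ ^ 2 := by
      intro s hs N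
      exact Torus.eGradNormSq_fourierTruncate_eq_sum ((hu.memLp s (Ioo_subset_Icc_self (hsub hs))).integrable one_le_two) N
    refine lintegral_tendsto_of_tendsto_of_monotone (fun N => (hG_m N).mono_measure hle) ?_ ?_
    · filter_upwards [ae_restrict_mem measurableSet_Ioo] with s hs
      intro N N' hNN'
      show G N s ≤ G N' s
      rw [hcoef s hs N, hcoef s hs N']
      exact mul_le_mul' le_rfl (Finset.sum_le_sum_of_subset (FunctionSpaces.Torus.freqBall_mono hNN'))
    · filter_upwards [ae_restrict_mem measurableSet_Ioo] with s hs
      have hsum := (ENNReal.summable (f := fun k : d → ℤ =>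
        ENNReal.ofReal (FunctionSpaces.Torus.freqNormSq k) *
          ‖mFourierCoeff (FunctionSpaces.EuclideanSpace.complexify ∘ u s) k‖ₑ ^ 2)).hasSum
      have h := ENNReal.Tendsto.const_mul (hsum.comp FunctionSpaces.Torus.tendsto_freqBall_atTop)
        (Or.inr (ENNReal.ofReal_ne_top (r := 4 * Real.pi ^ 2)))
      rw [← FunctionSpaces.Torus.eGradNormSq_eq_tsum] at h
      exact h.congr fun N => (hcoef s hs N).symm
  -- the limit is finite, so `toReal` is continuous there
  have hL' := (ENNReal.tendsto_toReal hfin).comp hL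
  -- the truncated dissipation as a Bochner integral over `(0, t]`
  refine hL'.congr fun N => ?_
  have hfinN : ∀ᵐ s ∂μt, G N s < ⊤ := ae_of_all _ fun s =>
    FunctionSpaces.Torus.eGradNormSq_lt_top (FunctionSpaces.Torus.isSmooth_fourierTruncate N _)
  rw [Function.comp_apply, ← integral_toReal ((hG_m N).mono_measure hle) hfinN, hμt,
    setIntegral_congr_set Ioo_ae_eq_Ioc]

end Limits

/-! ### Slice-level tools for the nonlinear term -/

section SliceTools

omit [DecidableEq d] in
/-- **The guarded class `L⁴(S; L⁴)` has finite `∫_S ∫ ‖u‖⁴`.** [folklore] -/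
theorem lintegral_lintegral_enorm_pow_four_lt_top_of_memLqLp {S : Set ℝ}
    {u : ℝ → UnitAddTorus d → EuclideanSpace ℝ d} (hu4 : MemLqLp 4 4 u S) :
    ∫⁻ s in S, ∫⁻ x, ‖u s x‖ₑ ^ 4 < ⊤ := by
  obtain ⟨hae, hfin⟩ := hu4
  have h4 : (4 : ℝ≥0∞) ≠ 0 := by norm_num
  have h4' : (4 : ℝ≥0∞) ≠ ⊤ := ENNReal.ofNat_ne_top
  rw [FluidPDE.eLqLpNorm_def, eLpNorm_lt_top_iff_lintegral_rpow_enorm_lt_top h4 h4'] at hfin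
  refine lt_of_le_of_lt (le_of_eq (lintegral_congr_ae ?_)) hfin
  filter_upwards [hae] with s hs
  rw [Real.enorm_eq_ofReal ENNReal.toReal_nonneg, ENNReal.ofReal_toReal hs.eLpNorm_ne_top,
    eLpNorm_eq_lintegral_rpow_enorm_toReal h4 h4', ENNReal.toReal_ofNat, ← ENNReal.rpow_mul]
  norm_num

/-- **In dimensions `2 ≤ d ≤ 4` the `L⁴` truncation error of an `H¹` field vanishes**:
`∫ ‖P_N v - v‖⁴ → 0` as `N → ∞` when `v ∈ L²` has `‖v‖_{H¹} < ∞` — the embedding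
`H¹(T^d) ⊂ L⁴(T^d)` (`Torus.lintegral_enorm_pow_four_le_eSobolevNorm`, Temam 1979, Ch. II §1.1,
Lemma 1.2) applied to `P_N v - v`, whose `H¹` norm is the tail `∑_{|k|>N} ⟨k⟩² ‖v̂(k)‖²` of a
convergent series. [cite: Temam1979, Ch. II §1.1 Lemma 1.2, (1.13)] -/
theorem tendsto_lintegral_enorm_pow_four_fourierTruncate_sub_of_card_le_four
    (hd2 : 2 ≤ Fintype.card d) (hd4 : Fintype.card d ≤ 4)
    {v : UnitAddTorus d → EuclideanSpace ℝ d} (hv : MemLp v 2 volume)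
    (hH : FunctionSpaces.Torus.eSobolevNorm 1 (FunctionSpaces.EuclideanSpace.complexify ∘ v) < ⊤) :
    Tendsto (fun N => ∫⁻ x, ‖FunctionSpaces.Torus.fourierTruncate N v x - v x‖ₑ ^ 4) atTop (𝓝 0) := by
  obtain ⟨K, hK⟩ := FunctionSpaces.Torus.lintegral_enorm_pow_four_le_eSobolevNorm hd2 hd4
  -- the weighted coefficient family and its tails
  set F : (d → ℤ) → ℝ≥0∞ := fun k => ENNReal.ofReal (FunctionSpaces.Torus.sobolevWeight 1 k ^ 2) *
    ‖mFourierCoeff (FunctionSpaces.EuclideanSpace.complexify ∘ v) k‖ₑ ^ 2 with hF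
  have hHF : FunctionSpaces.Torus.eSobolevNorm 1 (FunctionSpaces.EuclideanSpace.complexify ∘ v) =
      (∑' k, F k) ^ (1 / 2 : ℝ) := rfl
  have hFsum : ∑' k, F k ≠ ⊤ := by
    intro htop
    rw [hHF, htop, ENNReal.top_rpow_of_pos (by norm_num)] at hH
    exact lt_irrefl _ hH
  set Tl : ℕ → ℝ≥0∞ := fun N => ∑' k : {k : d → ℤ // k ∉ FunctionSpaces.Torus.freqBall N}, F k with hTl
  have hTl0 : Tendsto Tl atTop (𝓝 0) :=
    (ENNReal.tendsto_tsum_compl_atTop_zero hFsum).comp FunctionSpaces.Torus.tendsto_freqBall_atTop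
  -- the `H¹` norm of the truncation error is the tail
  have hHN : ∀ N, FunctionSpaces.Torus.eSobolevNorm 1
      (FunctionSpaces.EuclideanSpace.complexify ∘ (FunctionSpaces.Torus.fourierTruncate N v - v)) = Tl N ^ (1 / 2 : ℝ) := by
    intro N
    rw [FunctionSpaces.Torus.eSobolevNorm]
    congr 1
    rw [hTl]
    dsimp only
    rw [show (∑' k : {k : d → ℤ // k ∉ FunctionSpaces.Torus.freqBall N}, F k) =
        ∑' k : ({k : d → ℤ | k ∉ FunctionSpaces.Torus.freqBall N} : Set (d → ℤ)), F k from rfl,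
      tsum_subtype ({k : d → ℤ | k ∉ FunctionSpaces.Torus.freqBall N} : Set (d → ℤ)) F]
    refine tsum_congr fun k => ?_
    rw [FunctionSpaces.Torus.mFourierCoeff_fourierTruncate_sub (hv.integrable one_le_two)]
    simp only [Set.indicator_apply, Set.mem_setOf_eq, hF]
    by_cases hk : k ∈ FunctionSpaces.Torus.freqBall N
    · simp [hk]
    · simp [hk]
  -- bound and squeeze
  have hbd : ∀ N, ∫⁻ x, ‖FunctionSpaces.Torus.fourierTruncate N v x - v x‖ₑ ^ 4 ≤ K * (Tl N ^ (1 / 2 : ℝ)) ^ 4 := by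
    intro N
    have h := hK (FunctionSpaces.Torus.fourierTruncate N v - v) ((FunctionSpaces.Torus.memLp_fourierTruncate N v 2).sub hv)
    rw [hHN N] at h
    simpa only [Pi.sub_apply] using h
  have hlim : Tendsto (fun N => (K : ℝ≥0∞) * (Tl N ^ (1 / 2 : ℝ)) ^ 4) atTop (𝓝 0) := by
    have h1 : Tendsto (fun N => Tl N ^ (1 / 2 : ℝ)) atTop (𝓝 0) := by
      have hc := (ENNReal.continuous_rpow_const (y := (1 / 2 : ℝ))).tendsto 0
      rw [ENNReal.zero_rpow_of_pos (by norm_num)] at hc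
      exact hc.comp hTl0
    have h2 : Tendsto (fun N => (Tl N ^ (1 / 2 : ℝ)) ^ 4) atTop (𝓝 0) := by
      have := ((ENNReal.continuous_pow 4).tendsto 0).comp h1
      rwa [zero_pow four_ne_zero] at this
    have h3 := ENNReal.Tendsto.const_mul (a := (K : ℝ≥0∞)) h2 (Or.inr ENNReal.coe_ne_top)
    rwa [mul_zero] at h3
  exact tendsto_of_tendsto_of_tendsto_of_le_of_le tendsto_const_nhds hlim (fun _ => bot_le) hbd

/-- **The nonlinear term against the own truncation, rewritten**: for `v ∈ L²(T^d)` weakly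
divergence free, `∫⟪v, (v·∇)P_N v⟫ = ∫⟪v - P_N v, (v·∇)P_N v⟫`, because
`∫⟪P_N v, (v·∇)P_N v⟫ = 0` (weak incompressibility against `½|P_N v|²`; Kuksin–Shirikyan 2012,
(2.11)); hence by Hölder `(4, 4, 2)` and `‖∇P_N v‖₂ ≤ ‖∇v‖₂`
`‖∫⟪v, (v·∇)P_N v⟫‖ₑ ≤ ‖P_N v - v‖_{L⁴} ‖v‖_{L⁴} ‖∇v‖₂`. [cite: KuksinShirikyan2012, Prop. 2.1.7 (2.11), (2.16)] -/
theorem enorm_integral_inner_convect_fourierTruncate_self_le {v : UnitAddTorus d → EuclideanSpace ℝ d}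
    (hv : MemLp v 2 volume) (hdiv : FunctionSpaces.Torus.IsWeaklyDivFree v) (N : ℕ) :
    ‖∫ x, ⟪v x, FunctionSpaces.Torus.convect v (FunctionSpaces.Torus.fourierTruncate N v) x⟫‖ₑ ≤
      (∫⁻ x, ‖FunctionSpaces.Torus.fourierTruncate N v x - v x‖ₑ ^ 4) ^ (1 / 4 : ℝ) *
        (∫⁻ x, ‖v x‖ₑ ^ 4) ^ (1 / 4 : ℝ) * FunctionSpaces.Torus.eGradNormSq v ^ (1 / 2 : ℝ) := by
  set Φ := FunctionSpaces.Torus.fourierTruncate N v with hΦ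
  have hs : FunctionSpaces.Torus.IsSmooth Φ := FunctionSpaces.Torus.isSmooth_fourierTruncate _ _
  have hΦm : MemLp Φ 2 volume := hs.memLp 2
  have hvΦ : MemLp (v - Φ) 2 volume := hv.sub hΦm
  -- the rewriting
  have heq : ∫ x, ⟪v x, FunctionSpaces.Torus.convect v Φ x⟫ = ∫ x, ⟪(v - Φ) x, FunctionSpaces.Torus.convect v Φ x⟫ := by
    have hpt : ∀ x, ⟪v x, FunctionSpaces.Torus.convect v Φ x⟫ =
        ⟪(v - Φ) x, FunctionSpaces.Torus.convect v Φ x⟫ + ⟪Φ x, FunctionSpaces.Torus.convect v Φ x⟫ := by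
      intro x; rw [Pi.sub_apply, inner_sub_left]; ring
    simp_rw [hpt]
    rw [integral_add (integrable_inner_convect' hvΦ hv hs) (integrable_inner_convect' hΦm hv hs),
      integral_inner_self_convect_eq_zero_of_isWeaklyDivFree hdiv hs, add_zero]
  rw [heq]
  -- the bounds
  have b := lintegral_enorm_inner_convect_le hvΦ.1 hv.1 hs
  have hG : FunctionSpaces.Torus.eGradNormSq Φ ^ (1 / 2 : ℝ) ≤ FunctionSpaces.Torus.eGradNormSq v ^ (1 / 2 : ℝ) :=
    ENNReal.rpow_le_rpow (Torus.eGradNormSq_fourierTruncate_le (hv.integrable one_le_two) N) (by norm_num)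
  have hR : (∫⁻ x, ‖(v - Φ) x‖ₑ ^ 4) = ∫⁻ x, ‖Φ x - v x‖ₑ ^ 4 :=
    lintegral_congr fun x => by rw [Pi.sub_apply, enorm_sub_rev]
  calc ‖∫ x, ⟪(v - Φ) x, FunctionSpaces.Torus.convect v Φ x⟫‖ₑ
      ≤ ∫⁻ x, ‖⟪(v - Φ) x, FunctionSpaces.Torus.convect v Φ x⟫‖ₑ := enorm_integral_le_lintegral_enorm _
    _ ≤ (∫⁻ x, ‖(v - Φ) x‖ₑ ^ 4) ^ (1 / 4 : ℝ) * (∫⁻ x, ‖v x‖ₑ ^ 4) ^ (1 / 4 : ℝ) *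
          FunctionSpaces.Torus.eGradNormSq Φ ^ (1 / 2 : ℝ) := b
    _ ≤ _ := by rw [hR]; gcongr

omit [DecidableEq d] in
/-- **The raw Hölder bound of the nonlinear term against the own truncation**:
`‖∫⟪v, (v·∇)P_N v⟫‖ₑ ≤ ‖v‖_{L⁴}² ‖∇v‖₂` — uniform in `N` (`‖∇P_N v‖₂ ≤ ‖∇v‖₂`); it
dominates the term in time by `‖u(s)‖₄² ‖∇u(s)‖₂ ∈ L¹(0,T)` for `u ∈ L⁴L⁴ ∩ L²H¹` (Shinbrot
1974; Kuksin–Shirikyan 2012, (2.16)). [cite: KuksinShirikyan2012, Prop. 2.1.7 (2.16)] -/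
theorem enorm_integral_inner_convect_fourierTruncate_self_le' [DecidableEq d] {v : UnitAddTorus d → EuclideanSpace ℝ d}
    (hv : MemLp v 2 volume) (N : ℕ) :
    ‖∫ x, ⟪v x, FunctionSpaces.Torus.convect v (FunctionSpaces.Torus.fourierTruncate N v) x⟫‖ₑ ≤
      (∫⁻ x, ‖v x‖ₑ ^ 4) ^ (1 / 2 : ℝ) * FunctionSpaces.Torus.eGradNormSq v ^ (1 / 2 : ℝ) := by
  have hs : FunctionSpaces.Torus.IsSmooth (FunctionSpaces.Torus.fourierTruncate N v) :=
    FunctionSpaces.Torus.isSmooth_fourierTruncate _ _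
  have b := lintegral_enorm_inner_convect_le hv.1 hv.1 hs
  have hG : FunctionSpaces.Torus.eGradNormSq (FunctionSpaces.Torus.fourierTruncate N v) ^ (1 / 2 : ℝ) ≤
      FunctionSpaces.Torus.eGradNormSq v ^ (1 / 2 : ℝ) :=
    ENNReal.rpow_le_rpow (Torus.eGradNormSq_fourierTruncate_le (hv.integrable one_le_two) N) (by norm_num)
  have hsq : (∫⁻ x, ‖v x‖ₑ ^ 4) ^ (1 / 4 : ℝ) * (∫⁻ x, ‖v x‖ₑ ^ 4) ^ (1 / 4 : ℝ) = (∫⁻ x, ‖v x‖ₑ ^ 4) ^ (1 / 2 : ℝ) := by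
    rw [← ENNReal.rpow_add_of_nonneg _ _ (by norm_num) (by norm_num)]
    norm_num
  calc ‖∫ x, ⟪v x, FunctionSpaces.Torus.convect v (FunctionSpaces.Torus.fourierTruncate N v) x⟫‖ₑ
      ≤ ∫⁻ x, ‖⟪v x, FunctionSpaces.Torus.convect v (FunctionSpaces.Torus.fourierTruncate N v) x⟫‖ₑ :=
        enorm_integral_le_lintegral_enorm _
    _ ≤ _ := b
    _ ≤ (∫⁻ x, ‖v x‖ₑ ^ 4) ^ (1 / 4 : ℝ) * (∫⁻ x, ‖v x‖ₑ ^ 4) ^ (1 / 4 : ℝ) *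
          FunctionSpaces.Torus.eGradNormSq v ^ (1 / 2 : ℝ) := by gcongr
    _ = _ := by rw [hsq]

omit [DecidableEq d] in
/-- Cauchy–Schwarz for the pairing of two fields on `T^d`: `‖∫ ⟪w, φ⟫‖ₑ ≤ ‖w‖_{L²} ‖φ‖_{L²}`. [folklore] -/
theorem enorm_integral_inner_le_eLpNorm_two_mul {w φ : UnitAddTorus d → EuclideanSpace ℝ d}
    (hw : AEStronglyMeasurable w volume) (hφ : AEStronglyMeasurable φ volume) :
    ‖∫ x, ⟪w x, φ x⟫‖ₑ ≤ eLpNorm w 2 volume * eLpNorm φ 2 volume := by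
  have h1 : ‖∫ x, ⟪w x, φ x⟫‖ₑ ≤ ∫⁻ x, ‖w x‖ₑ * ‖φ x‖ₑ := by
    refine (enorm_integral_le_lintegral_enorm _).trans (lintegral_mono fun x => ?_)
    rw [← ofReal_norm, ← ofReal_norm, ← ofReal_norm, ← ENNReal.ofReal_mul (norm_nonneg _)]
    exact ENNReal.ofReal_le_ofReal (norm_inner_le_norm _ _)
  have h2 : ∫⁻ x, ‖w x‖ₑ * ‖φ x‖ₑ ≤
      (∫⁻ x, ‖w x‖ₑ ^ 2) ^ (1 / 2 : ℝ) * (∫⁻ x, ‖φ x‖ₑ ^ 2) ^ (1 / 2 : ℝ) := by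
    have h := ENNReal.lintegral_mul_le_Lp_mul_Lq volume Real.HolderConjugate.two_two hw.enorm hφ.enorm
    simpa only [Pi.mul_apply, ENNReal.rpow_two, one_div] using h
  have h3 : ∀ f : UnitAddTorus d → EuclideanSpace ℝ d,
      (∫⁻ x, ‖f x‖ₑ ^ 2) ^ (1 / 2 : ℝ) = eLpNorm f 2 volume := fun f => by
    rw [eLpNorm_eq_lintegral_rpow_enorm_toReal two_ne_zero ENNReal.ofNat_ne_top, ENNReal.toReal_ofNat]
    simp only [ENNReal.rpow_two]
  rw [← h3 w, ← h3 φ]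
  exact h1.trans h2

/-- `‖P_N v‖_{L²} ≤ ‖v‖_{L²}` (Bessel). [folklore] -/
theorem eLpNorm_fourierTruncate_le {v : UnitAddTorus d → EuclideanSpace ℝ d} (hv : MemLp v 2 volume) (N : ℕ) :
    eLpNorm (FunctionSpaces.Torus.fourierTruncate N v) 2 volume ≤ eLpNorm v 2 volume := by
  have h := Torus.lintegral_enorm_sq_fourierTruncate_le hv N
  have h3 : ∀ f : UnitAddTorus d → EuclideanSpace ℝ d,
      (∫⁻ x, ‖f x‖ₑ ^ 2) ^ (1 / 2 : ℝ) = eLpNorm f 2 volume := fun f => by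
    rw [eLpNorm_eq_lintegral_rpow_enorm_toReal two_ne_zero ENNReal.ofNat_ne_top, ENNReal.toReal_ofNat]
    simp only [ENNReal.rpow_two]
  rw [← h3, ← h3]
  exact ENNReal.rpow_le_rpow h (by norm_num)

end SliceTools

/-! ### Time measurability of the work against truncations -/

section WorkMeasurability

variable {μ : Measure ℝ} {a c : ℝ → UnitAddTorus d → EuclideanSpace ℝ d}

/-- Joint measurability of `(t, x) ↦ ⟪a t x, P_N (c t) x⟫` for jointly measurable families. [folklore] -/
theorem aestronglyMeasurable_uncurry_inner_fourierTruncate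
    (ha : AEStronglyMeasurable (uncurry a) (μ.prod volume)) (hc : AEStronglyMeasurable (uncurry c) (μ.prod volume))
    (N : ℕ) :
    AEStronglyMeasurable (uncurry fun t x => ⟪a t x, FunctionSpaces.Torus.fourierTruncate N (c t) x⟫) (μ.prod volume) := by
  have h : (uncurry fun t x => ⟪a t x, FunctionSpaces.Torus.fourierTruncate N (c t) x⟫) =
      fun z => ⟪uncurry a z, uncurry (fun t x => FunctionSpaces.Torus.fourierTruncate N (c t) x) z⟫ := by
    funext z
    rfl
  rw [h]
  exact ha.inner (aestronglyMeasurable_uncurry_fourierTruncate hc N)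

/-- **Time measurability of the work against truncations**: `t ↦ ∫ ⟪a t, P_N (c t)⟫` is a.e.
strongly measurable (Fubini measurability). [folklore] -/
theorem aestronglyMeasurable_integral_inner_fourierTruncate
    (ha : AEStronglyMeasurable (uncurry a) (μ.prod volume)) (hc : AEStronglyMeasurable (uncurry c) (μ.prod volume))
    (N : ℕ) :
    AEStronglyMeasurable (fun t => ∫ x, ⟪a t x, FunctionSpaces.Torus.fourierTruncate N (c t) x⟫) μ :=
  (aestronglyMeasurable_uncurry_inner_fourierTruncate ha hc N).integral_prod_right'

end WorkMeasurability

/-! ### The nonlinear and work terms in time: dominated convergence -/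

section TimeLimits

variable {T ν : ℝ} {f u : ℝ → UnitAddTorus d → EuclideanSpace ℝ d}
  {u₀ : UnitAddTorus d → EuclideanSpace ℝ d}

/-- **The nonlinear term of the truncated identity vanishes in the limit** (Lions 1960; Shinbrot
1974, the step `∫∫ (u·∇)u · u_h → ∫∫ (u·∇)u · u = 0`): for a Leray–Hopf solution on `T^d`,
`2 ≤ d ≤ 4`, with `u ∈ L⁴(0,T; L⁴)`, and every `t ∈ (0, T]`,
`∫_{(0,t]} ∫⟪u, (u·∇)P_N u⟫ ds → 0` as `N → ∞` — dominated convergence in time: the slice term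
tends to `0` (`Torus.enorm_integral_inner_convect_fourierTruncate_self_le` with the `L⁴`
truncation error of an `H¹` slice, `Torus.tendsto_lintegral_enorm_pow_four_fourierTruncate_sub_of_card_le_four`)
and is dominated by `‖u(s)‖₄² ‖∇u(s)‖₂ ∈ L¹(0,T)` (Cauchy–Schwarz in time). [cite: Shinbrot1974, Thm. (proof)] -/
theorem IsLerayHopfOn.tendsto_setIntegral_inner_convect_fourierTruncate_self (hu : IsLerayHopfOn T ν f u₀ u)
    (hd2 : 2 ≤ Fintype.card d) (hd4 : Fintype.card d ≤ 4) (hu4 : MemLqLp 4 4 u (Ioo 0 T))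
    {t : ℝ} (ht : t ∈ Ioc 0 T) :
    (∀ N, IntegrableOn (fun s =>
        ∫ x, ⟪u s x, FunctionSpaces.Torus.convect (u s) (FunctionSpaces.Torus.fourierTruncate N (u s)) x⟫) (Ioc 0 t)) ∧
    Tendsto (fun N => ∫ s in Ioc 0 t,
        ∫ x, ⟪u s x, FunctionSpaces.Torus.convect (u s) (FunctionSpaces.Torus.fourierTruncate N (u s)) x⟫)
      atTop (𝓝 0) := by
  set μT : Measure ℝ := volume.restrict (Ioo 0 T) with hμT
  set μt : Measure ℝ := volume.restrict (Ioo 0 t) with hμt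
  have hsub : Ioo 0 t ⊆ Ioo 0 T := Ioo_subset_Ioo le_rfl ht.2
  have hle : μt ≤ μT := Measure.restrict_mono hsub le_rfl
  -- ### time densities
  set U4 : ℝ → ℝ≥0∞ := fun s => ∫⁻ x, ‖u s x‖ₑ ^ 4 with hU4
  set g : ℝ → ℝ≥0∞ := fun s => FunctionSpaces.Torus.eGradNormSq (u s) with hg
  set B : ℝ → ℝ≥0∞ := fun s => U4 s ^ (1 / 2 : ℝ) * g s ^ (1 / 2 : ℝ) with hB
  set F : ℕ → ℝ → ℝ := fun N s =>
    ∫ x, ⟪u s x, FunctionSpaces.Torus.convect (u s) (FunctionSpaces.Torus.fourierTruncate N (u s)) x⟫ with hF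
  -- ### measurability
  have hU4m : AEMeasurable U4 μT := hu.aemeasurable_lintegral_enorm_pow 4
  have hgm : AEMeasurable g μT := hu.aemeasurable_eGradNormSq
  have hBm : AEMeasurable B μT := (hU4m.pow_const _).mul (hgm.pow_const _)
  have hu' := hu.aestronglyMeasurable_uncurry
  have hu't : AEStronglyMeasurable (uncurry u) (μt.prod volume) :=
    hu'.mono_measure (Measure.prod_mono hle le_rfl)
  have hFm : ∀ N, AEStronglyMeasurable (F N) μt := fun N =>
    aestronglyMeasurable_integral_inner_convect_fourierTruncate hu't hu't hu't N
  -- ### finiteness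
  have hU4fin : ∫⁻ s, U4 s ∂μT < ⊤ := lintegral_lintegral_enorm_pow_four_lt_top_of_memLqLp hu4
  have hgfin : ∫⁻ s, g s ∂μT < ⊤ := hu.lintegral_eGradNormSq_lt_top
  have hBfin : ∫⁻ s, B s ∂μt ≠ ⊤ := by
    have h := ENNReal.lintegral_mul_le_Lp_mul_Lq μt Real.HolderConjugate.two_two
      ((hU4m.mono_measure hle).pow_const (1 / 2 : ℝ)) ((hgm.mono_measure hle).pow_const (1 / 2 : ℝ))
    have e : ∀ x : ℝ≥0∞, (x ^ (1 / 2 : ℝ)) ^ (2 : ℝ) = x := fun x => by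
      rw [← ENNReal.rpow_mul]; norm_num
    simp only [Pi.mul_apply, e] at h
    refine ne_top_of_le_ne_top (ENNReal.mul_ne_top ?_ ?_) h
    · exact ENNReal.rpow_ne_top_of_nonneg (by norm_num) ((lintegral_mono' hle le_rfl).trans_lt hU4fin).ne
    · exact ENNReal.rpow_ne_top_of_nonneg (by norm_num) ((lintegral_mono' hle le_rfl).trans_lt hgfin).ne
  have hbound_int : Integrable (fun s => (B s).toReal) μt :=
    integrable_toReal_of_lintegral_ne_top (hBm.mono_measure hle) hBfin
  -- ### a.e. finiteness of the densities on `(0, t)`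
  have hU4ae : ∀ᵐ s ∂μt, U4 s < ⊤ := (ae_lt_top' hU4m hU4fin.ne).filter_mono (ae_mono hle)
  have hgae : ∀ᵐ s ∂μt, g s < ⊤ := (ae_lt_top' hgm hgfin.ne).filter_mono (ae_mono hle)
  -- ### domination
  have h_bound : ∀ N, ∀ᵐ s ∂μt, ‖F N s‖ ≤ (B s).toReal := by
    intro N
    filter_upwards [hU4ae, hgae, ae_restrict_mem measurableSet_Ioo] with s hU hG hs
    have hmem : MemLp (u s) 2 volume := hu.memLp s (Ioo_subset_Icc_self (hsub hs))
    have h1 := enorm_integral_inner_convect_fourierTruncate_self_le' hmem N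
    have hBs : B s ≠ ⊤ := ENNReal.mul_ne_top (ENNReal.rpow_ne_top_of_nonneg (by norm_num) hU.ne)
      (ENNReal.rpow_ne_top_of_nonneg (by norm_num) hG.ne)
    have h2 := ENNReal.toReal_mono hBs h1
    rwa [Real.enorm_eq_ofReal_abs, ENNReal.toReal_ofReal (abs_nonneg _), ← Real.norm_eq_abs] at h2
  -- ### slice convergence for a.e. time
  have h_lim : ∀ᵐ s ∂μt, Tendsto (fun N => F N s) atTop (𝓝 0) := by
    have h4ae : ∀ᵐ s ∂μT, MemLp (u s) 4 volume := hu4.1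
    have hSob : ∀ᵐ s ∂μT, FunctionSpaces.Torus.MemSobolev 1 (FunctionSpaces.EuclideanSpace.complexify ∘ u s) :=
      hu.memL2Sobolev.1
    filter_upwards [h4ae.filter_mono (ae_mono hle), hSob.filter_mono (ae_mono hle), hgae,
      ae_restrict_mem measurableSet_Ioo] with s h4 hS hG hs
    have hsT : s ∈ Ioc 0 T := ⟨hs.1, hs.2.le.trans ht.2⟩
    have hmem : MemLp (u s) 2 volume := hu.memLp s (Ioc_subset_Icc_self hsT)
    have hdiv := hu.isWeaklyDivFree_of_mem_Ioc hsT
    -- the `L⁴` truncation error vanishes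
    have hR := tendsto_lintegral_enorm_pow_four_fourierTruncate_sub_of_card_le_four hd2 hd4 hmem hS.2
    -- finiteness of the fixed factors
    have hU4s : U4 s ≠ ⊤ := by
      have h := lintegral_rpow_enorm_lt_top_of_eLpNorm_lt_top (by norm_num : (4 : ℝ≥0∞) ≠ 0)
        ENNReal.ofNat_ne_top h4.eLpNorm_lt_top
      simpa only [ENNReal.toReal_ofNat, ENNReal.rpow_ofNat] using h.ne
    have hfac : U4 s ^ (1 / 4 : ℝ) * g s ^ (1 / 2 : ℝ) ≠ ⊤ :=
      ENNReal.mul_ne_top (ENNReal.rpow_ne_top_of_nonneg (by norm_num) hU4s)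
        (ENNReal.rpow_ne_top_of_nonneg (by norm_num) hG.ne)
    -- the bound and its limit
    have hbd : ∀ N, ‖F N s‖ₑ ≤ (∫⁻ x, ‖FunctionSpaces.Torus.fourierTruncate N (u s) x - u s x‖ₑ ^ 4) ^ (1 / 4 : ℝ) *
        (U4 s ^ (1 / 4 : ℝ) * g s ^ (1 / 2 : ℝ)) := fun N => by
      rw [← mul_assoc]
      exact enorm_integral_inner_convect_fourierTruncate_self_le hmem hdiv N
    have hlim0 : Tendsto (fun N => (∫⁻ x, ‖FunctionSpaces.Torus.fourierTruncate N (u s) x - u s x‖ₑ ^ 4) ^ (1 / 4 : ℝ) *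
        (U4 s ^ (1 / 4 : ℝ) * g s ^ (1 / 2 : ℝ))) atTop (𝓝 0) := by
      have h1 : Tendsto (fun N => (∫⁻ x, ‖FunctionSpaces.Torus.fourierTruncate N (u s) x - u s x‖ₑ ^ 4) ^ (1 / 4 : ℝ))
          atTop (𝓝 0) := by
        have hc := (ENNReal.continuous_rpow_const (y := (1 / 4 : ℝ))).tendsto 0
        rw [ENNReal.zero_rpow_of_pos (by norm_num)] at hc
        exact hc.comp hR
      have h2 := ENNReal.Tendsto.mul_const h1 (Or.inr hfac)
      rwa [zero_mul] at h2
    have hen : Tendsto (fun N => ‖F N s‖ₑ) atTop (𝓝 0) :=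
      tendsto_of_tendsto_of_tendsto_of_le_of_le tendsto_const_nhds hlim0 (fun _ => bot_le) hbd
    -- back to real numbers
    have hnorm : Tendsto (fun N => ‖F N s‖) atTop (𝓝 0) := by
      have h := (ENNReal.tendsto_toReal ENNReal.zero_ne_top).comp hen
      rw [ENNReal.toReal_zero] at h
      refine h.congr fun N => ?_
      rw [Function.comp_apply, Real.enorm_eq_ofReal_abs, ENNReal.toReal_ofReal (abs_nonneg _), Real.norm_eq_abs]
    exact tendsto_zero_iff_norm_tendsto_zero.2 hnorm
  -- ### integrability and dominated convergence
  have hInt : ∀ N, IntegrableOn (F N) (Ioc 0 t) := fun N => by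
    rw [IntegrableOn, ← Measure.restrict_congr_set Ioo_ae_eq_Ioc]
    exact hbound_int.mono' (hFm N) (h_bound N)
  refine ⟨hInt, ?_⟩
  have hDC := tendsto_integral_of_dominated_convergence (fun s => (B s).toReal) hFm hbound_int h_bound h_lim
  rw [integral_zero] at hDC
  refine hDC.congr fun N => ?_
  rw [hμt, setIntegral_congr_set Ioo_ae_eq_Ioc]

/-- **The work of the force against the truncations converges**: for a Leray–Hopf solution with
a jointly measurable force `f ∈ L¹(0,T; L²)` and every `t ∈ (0, T]`,
`∫_{(0,t]} ∫⟪f, P_N u⟫ ds → ∫_{(0,t]} ∫⟪f, u⟫ ds` — dominated convergence in time: slice-wise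
`∫⟪f(s), P_N u(s)⟫ → ∫⟪f(s), u(s)⟫` (Parseval), dominated by `‖f(s)‖₂ ‖u(s)‖₂ ≤ C^{1/2}‖f(s)‖₂`. [folklore] -/
theorem IsLerayHopfOn.tendsto_setIntegral_work_fourierTruncate (hu : IsLerayHopfOn T ν f u₀ u)
    (hfm : AEStronglyMeasurable (FunctionSpaces.Torus.stLift f) (volume.restrict (Ioo 0 T ×ˢ univ)))
    (hf : MemLqLp 1 2 f (Ioo 0 T)) {t : ℝ} (ht : t ∈ Ioc 0 T) :
    (∀ N, IntegrableOn (fun s => ∫ x, ⟪f s x, FunctionSpaces.Torus.fourierTruncate N (u s) x⟫) (Ioc 0 t)) ∧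
    Tendsto (fun N => ∫ s in Ioc 0 t, ∫ x, ⟪f s x, FunctionSpaces.Torus.fourierTruncate N (u s) x⟫)
      atTop (𝓝 (∫ s in Ioc 0 t, ∫ x, ⟪f s x, u s x⟫)) := by
  set μT : Measure ℝ := volume.restrict (Ioo 0 T) with hμT
  set μt : Measure ℝ := volume.restrict (Ioo 0 t) with hμt
  have hsub : Ioo 0 t ⊆ Ioo 0 T := Ioo_subset_Ioo le_rfl ht.2
  have hle : μt ≤ μT := Measure.restrict_mono hsub le_rfl
  obtain ⟨hfs, hNint⟩ := force_L1L2_bookkeeping hfm hf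
  obtain ⟨C₀, hC₀⟩ := hu.energy_bound
  -- ### measurability
  have hu' := hu.aestronglyMeasurable_uncurry
  have hf' : AEStronglyMeasurable (uncurry f) (μT.prod volume) := by
    have h := FunctionSpaces.Torus.aestronglyMeasurable_uncurry_of_stLift_restrict hfm
    rwa [Measure.volume_eq_prod, ← Measure.prod_restrict, Measure.restrict_univ] at h
  have hprod : μt.prod (volume : Measure (UnitAddTorus d)) ≤ μT.prod volume := Measure.prod_mono hle le_rfl
  have hu't : AEStronglyMeasurable (uncurry u) (μt.prod volume) := hu'.mono_measure hprod
  have hf't : AEStronglyMeasurable (uncurry f) (μt.prod volume) := hf'.mono_measure hprod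
  set F : ℕ → ℝ → ℝ := fun N s => ∫ x, ⟪f s x, FunctionSpaces.Torus.fourierTruncate N (u s) x⟫ with hF
  have hFm : ∀ N, AEStronglyMeasurable (F N) μt := fun N =>
    aestronglyMeasurable_integral_inner_fourierTruncate hf't hu't N
  -- ### the dominating function `C₀^{1/2} ‖f(s)‖₂`
  set K : ℝ≥0∞ := (C₀ : ℝ≥0∞) ^ (1 / 2 : ℝ) with hK
  have hKtop : K ≠ ⊤ := ENNReal.rpow_ne_top_of_nonneg (by norm_num) ENNReal.coe_ne_top
  have hbound_int : Integrable (fun s => K.toReal * (eLpNorm (f s) 2 volume).toReal) μt :=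
    (hNint.mono_measure hle).const_mul _
  have h_bound : ∀ N, ∀ᵐ s ∂μt, ‖F N s‖ ≤ K.toReal * (eLpNorm (f s) 2 volume).toReal := by
    intro N
    filter_upwards [hC₀.filter_mono (ae_mono hle), hfs.filter_mono (ae_mono hle),
      ae_restrict_mem measurableSet_Ioo] with s hC hfs2 hs
    have hmem : MemLp (u s) 2 volume := hu.memLp s (Ioo_subset_Icc_self (hsub hs))
    -- `‖u(s)‖₂ ≤ K`
    have huK : eLpNorm (u s) 2 volume ≤ K := by
      rw [hK, eLpNorm_eq_lintegral_rpow_enorm_toReal two_ne_zero ENNReal.ofNat_ne_top, ENNReal.toReal_ofNat]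
      simp only [ENNReal.rpow_two]
      exact ENNReal.rpow_le_rpow hC (by norm_num)
    have h1 := enorm_integral_inner_le_eLpNorm_two_mul hfs2.1
      (FunctionSpaces.Torus.memLp_fourierTruncate N (u s) 2).1
    have h2 : ‖F N s‖ₑ ≤ eLpNorm (f s) 2 volume * K :=
      h1.trans (mul_le_mul' le_rfl ((eLpNorm_fourierTruncate_le hmem N).trans huK))
    have hfin : eLpNorm (f s) 2 volume * K ≠ ⊤ := ENNReal.mul_ne_top hfs2.eLpNorm_ne_top hKtop
    have h3 := ENNReal.toReal_mono hfin h2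
    rw [Real.enorm_eq_ofReal_abs, ENNReal.toReal_ofReal (abs_nonneg _), ← Real.norm_eq_abs,
      ENNReal.toReal_mul] at h3
    linarith [h3]
  -- ### slice convergence for a.e. time
  have h_lim : ∀ᵐ s ∂μt, Tendsto (fun N => F N s) atTop (𝓝 (∫ x, ⟪f s x, u s x⟫)) := by
    filter_upwards [hfs.filter_mono (ae_mono hle), ae_restrict_mem measurableSet_Ioo] with s hfs2 hs
    have hmem : MemLp (u s) 2 volume := hu.memLp s (Ioo_subset_Icc_self (hsub hs))
    exact tendsto_integral_inner_fourierTruncate hfs2 hmem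
  -- ### integrability and dominated convergence
  have hInt : ∀ N, IntegrableOn (F N) (Ioc 0 t) := fun N => by
    rw [IntegrableOn, ← Measure.restrict_congr_set Ioo_ae_eq_Ioc]
    exact hbound_int.mono' (hFm N) (h_bound N)
  refine ⟨hInt, ?_⟩
  have hDC := tendsto_integral_of_dominated_convergence (fun s => K.toReal * (eLpNorm (f s) 2 volume).toReal)
    hFm hbound_int h_bound h_lim
  rw [hμt, setIntegral_congr_set Ioo_ae_eq_Ioc] at hDC
  refine hDC.congr fun N => ?_
  rw [setIntegral_congr_set Ioo_ae_eq_Ioc]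

end TimeLimits

end Torus

/-! ### The corrected statement of `lions_energy_equality`, proved -/

section Corrected

variable {d : Type*} [Fintype d] [DecidableEq d] {T ν : ℝ}
  {f u : ℝ → UnitAddTorus d → EuclideanSpace ℝ d} {u₀ : UnitAddTorus d → EuclideanSpace ℝ d}

/-- **Lions' energy equality on `T^d × (0, T]`, `2 ≤ d ≤ 4` — the corrected form of the refuted
`Literature.Analysis.FluidPDE.lions_energy_equality`** (J.-L. Lions, Rend. Sem. Mat. Univ.
Padova 30 (1960); Shinbrot, SIAM J. Math. Anal. 5 (1974), Thm., case `p = r = 4`; as restated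
in Beirão da Veiga–Yang, Nonlinear Anal. 196 (2020) = arXiv:1912.10249, Thm. 1.1 (i): a
Leray–Hopf weak solution with `u ∈ L⁴(0,T; L⁴)` satisfies the energy equality for every time).
Let `u` be a Leray–Hopf weak solution of the forced Navier–Stokes (`ν > 0`) or Euler (`ν = 0`)
system on `T^d × [0, T)` (`Torus.IsLerayHopfOn`, hence in `L²(0,T;H¹)` spectrally; no sign
condition on `ν` is needed, the original's `0 ≤ ν` is dropped) with datum
`u₀ ∈ L²`, a jointly measurable force `f ∈ L¹(0,T; L²)`, and `u ∈ L⁴(0,T; L⁴)`. Then for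
**every `t ∈ (0, T]`**
`½‖u(t)‖² + ν ∫₀ᵗ ‖∇u‖₂² = ½‖u₀‖² + ∫₀ᵗ∫ ⟪f, u⟫`,
the dissipation being the spectral `Torus.eGradNormSq`.

**Discrepancies with the vendored `lions_energy_equality` (refuted in
`FluidPDE/DuchonRobertLionsCounterexample`)**: (1) the conclusion ranges over `t ∈ Ioc 0 T`,
not `Icc 0 T` — no clause of `Torus.IsLerayHopfOn` constrains the slice `u 0`, and in the printed
theorems `u(0) = u₀` makes `t = 0` the tautology `‖u₀‖² = ‖u₀‖²`; (2) `u₀ ∈ L²` and the joint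
measurability of `f` on `(0,T) × T^d` are explicit (the guarded `MemLqLp 1 2 f` of the original
has no joint measurability, and `IsLerayHopfOn` does not imply the measurability of `u₀`; both
are part of the printed setting `u₀ ∈ H`, `f ∈ L¹(0,T;L²)`); (3) dimensions `2 ≤ d ≤ 4` (the
printed results are three-dimensional; the restriction is that of the tree's embedding
`H¹(T^d) ⊂ L⁴(T^d)`, `Torus.lintegral_enorm_pow_four_le_eSobolevNorm`, used to remove the
Fourier truncation inside the trilinear term; Shinbrot's time-mollification argument is
dimension-free).

Proof: the Galerkin/Fourier-truncation form of Lions–Shinbrot. At level `N` the exact identity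
`‖P_N u(t)‖² = ‖P_N u₀‖² + 2∫₀ᵗ (∫⟪u,(u·∇)P_N u⟫ - ν‖∇P_N u‖₂² + ∫⟪f, P_N u⟫)`
(`Torus.IsLerayHopfOn.integral_inner_fourierTruncate_self_eq`, the diagonal of Serrin's cross
identity, from the time-sliced weak formulation and the product formula for primitives); then
`N → ∞`: Parseval on the energies, monotone convergence on the dissipation, dominated convergence
on the work (`‖f‖₂‖u‖₂`), and on the nonlinear term, which tends to `0` slice-wise because
`∫⟪P_N u,(u·∇)P_N u⟫ = 0` (weak incompressibility) leaves `∫⟪u - P_N u,(u·∇)P_N u⟫`, bounded by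
`‖u - P_N u‖₄‖u‖₄‖∇u‖₂` (Hölder; `H¹ ⊂ L⁴` on the truncation error), and is dominated by
`‖u(s)‖₄²‖∇u(s)‖₂ ∈ L¹(0,T)` (`u ∈ L⁴L⁴ ∩ L²H¹`). [cite: Shinbrot1974, Thm. (p = r = 4: Lions 1960)] -/
theorem lions_energy_equality_Ioc (hd2 : 2 ≤ Fintype.card d) (hd4 : Fintype.card d ≤ 4)
    (hLH : Torus.IsLerayHopfOn T ν f u₀ u) (hu₀ : MemLp u₀ 2 volume)
    (hu4 : Torus.MemLqLp 4 4 u (Ioo 0 T))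
    (hfm : AEStronglyMeasurable (FunctionSpaces.Torus.stLift f) (volume.restrict (Ioo 0 T ×ˢ univ)))
    (hf : Torus.MemLqLp 1 2 f (Ioo 0 T)) :
    ∀ t ∈ Ioc 0 T,
      FunctionSpaces.Torus.kineticEnergy (u t) + ν * (∫⁻ τ in Ioo 0 t, FunctionSpaces.Torus.eGradNormSq (u τ)).toReal =
        FunctionSpaces.Torus.kineticEnergy u₀ + ∫ τ in 0..t, ∫ x, ⟪f τ x, u τ x⟫ := by
  intro t ht
  have hT : 0 < T := ht.1.trans_le ht.2
  have ht' : t ∈ Icc 0 T := ⟨ht.1.le, ht.2⟩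
  -- ### the five sequences
  set L : ℕ → ℝ := fun N => ∫ x, ⟪FunctionSpaces.Torus.fourierTruncate N (u t) x, FunctionSpaces.Torus.fourierTruncate N (u t) x⟫ with hL
  set L₀ : ℕ → ℝ := fun N => ∫ x, ⟪FunctionSpaces.Torus.fourierTruncate N u₀ x, FunctionSpaces.Torus.fourierTruncate N u₀ x⟫ with hL₀
  set NL : ℕ → ℝ := fun N => ∫ s in Ioc 0 t,
    ∫ x, ⟪u s x, FunctionSpaces.Torus.convect (u s) (FunctionSpaces.Torus.fourierTruncate N (u s)) x⟫ with hNL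
  set D : ℕ → ℝ := fun N => ∫ s in Ioc 0 t,
    (FunctionSpaces.Torus.eGradNormSq (FunctionSpaces.Torus.fourierTruncate N (u s))).toReal with hD
  set W : ℕ → ℝ := fun N => ∫ s in Ioc 0 t, ∫ x, ⟪f s x, FunctionSpaces.Torus.fourierTruncate N (u s) x⟫ with hW
  obtain ⟨hNLint, hNLlim⟩ := hLH.tendsto_setIntegral_inner_convect_fourierTruncate_self hd2 hd4 hu4 ht
  obtain ⟨hDint, hDlim⟩ := hLH.tendsto_setIntegral_toReal_eGradNormSq_fourierTruncate ht
  obtain ⟨hWint, hWlim⟩ := hLH.tendsto_setIntegral_work_fourierTruncate hfm hf ht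
  -- ### the identity at level `N`
  have hN : ∀ N, L N = L₀ N + 2 * ((NL N - ν * D N) + W N) := by
    intro N
    obtain ⟨hΦint, hid⟩ := hLH.integral_inner_fourierTruncate_self_eq hT hfm hf hu₀ N ht
    -- split the flux for a.e. `s ∈ (0, t]`
    have h1 : ∀ᵐ s ∂(volume.restrict (Ioc 0 T)), Integrable (f s) volume := by
      rw [← Measure.restrict_congr_set Ioo_ae_eq_Ioc]
      exact Torus.ae_integrable_force_slice' hf
    have hsplit : ∀ᵐ s ∂(volume.restrict (Ioc 0 t)),
        (∫ x, (⟪u s x, FunctionSpaces.Torus.convect (u s) (FunctionSpaces.Torus.fourierTruncate N (u s)) x⟫ +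
          ν * ⟪u s x, FunctionSpaces.Torus.laplacian (FunctionSpaces.Torus.fourierTruncate N (u s)) x⟫ +
          ⟪f s x, FunctionSpaces.Torus.fourierTruncate N (u s) x⟫)) =
        (∫ x, ⟪u s x, FunctionSpaces.Torus.convect (u s) (FunctionSpaces.Torus.fourierTruncate N (u s)) x⟫) -
          ν * (FunctionSpaces.Torus.eGradNormSq (FunctionSpaces.Torus.fourierTruncate N (u s))).toReal +
          ∫ x, ⟪f s x, FunctionSpaces.Torus.fourierTruncate N (u s) x⟫ := by
      filter_upwards [ae_restrict_of_ae_restrict_of_subset (Ioc_subset_Ioc_right ht.2) h1,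
        ae_restrict_mem measurableSet_Ioc] with s hs hsI
      exact Torus.flux_fourierTruncate_self_split (hLH.memLp s ⟨hsI.1.le, hsI.2.trans ht.2⟩) hs ν N
    have iD : IntegrableOn (fun s => ν * (FunctionSpaces.Torus.eGradNormSq (FunctionSpaces.Torus.fourierTruncate N (u s))).toReal)
        (Ioc 0 t) := (hDint N).const_mul ν
    have iND : IntegrableOn (fun s =>
        (∫ x, ⟪u s x, FunctionSpaces.Torus.convect (u s) (FunctionSpaces.Torus.fourierTruncate N (u s)) x⟫) -
          ν * (FunctionSpaces.Torus.eGradNormSq (FunctionSpaces.Torus.fourierTruncate N (u s))).toReal) (Ioc 0 t) :=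
      (hNLint N).sub iD
    rw [hL, hL₀, hNL, hD, hW]
    dsimp only
    rw [hid, integral_congr_ae hsplit, integral_add iND (hWint N), integral_sub (hNLint N) iD, integral_const_mul]
  -- ### the limits
  have hLlim : Tendsto L atTop (𝓝 (∫ x, ‖u t x‖ ^ 2)) := Torus.tendsto_integral_inner_fourierTruncate_self (hLH.memLp t ht')
  have hL₀lim : Tendsto L₀ atTop (𝓝 (∫ x, ‖u₀ x‖ ^ 2)) := Torus.tendsto_integral_inner_fourierTruncate_self hu₀
  have hRlim : Tendsto (fun N => L₀ N + 2 * ((NL N - ν * D N) + W N)) atTop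
      (𝓝 ((∫ x, ‖u₀ x‖ ^ 2) + 2 * ((0 - ν * (∫⁻ s in Ioo 0 t, FunctionSpaces.Torus.eGradNormSq (u s)).toReal) +
        ∫ s in Ioc 0 t, ∫ x, ⟪f s x, u s x⟫))) :=
    hL₀lim.add (((hNLlim.sub (hDlim.const_mul ν)).add hWlim).const_mul 2)
  have hLlim' : Tendsto L atTop
      (𝓝 ((∫ x, ‖u₀ x‖ ^ 2) + 2 * ((0 - ν * (∫⁻ s in Ioo 0 t, FunctionSpaces.Torus.eGradNormSq (u s)).toReal) +
        ∫ s in Ioc 0 t, ∫ x, ⟪f s x, u s x⟫))) :=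
    hRlim.congr fun N => (hN N).symm
  have key := tendsto_nhds_unique hLlim hLlim'
  -- ### conclusion
  rw [intervalIntegral.integral_of_le ht.1.le]
  simp only [FunctionSpaces.Torus.kineticEnergy]
  linarith

end Corrected

end Literature.Analysis.FluidPDE

end
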